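import Literature.MathematicalPhysics.QuantumFieldTheory.Balaban1983to89.B9Ineq377POneRightKernel
import Literature.MathematicalPhysics.QuantumFieldTheory.Balaban1983to89.B9Thm34PPrimeKernelFinal

/-!
# `Balaban1983to89.B9Ineq377POneKernelFinal` — [Balaban1985BackgroundPropagators] (3.77) p. 406 «|P_{1,μν}(A;x,x′)| ≦ O(1)α₁(Lʲη)⁻²(L^{j′}η)^{−d}
# e^{−(1/2)δ₀d(y,y′)}» IN THE PRINTED POINTWISE-KERNEL FORM FOR PRINT'S OWN `P₁(A)` OF (3.76), every input — (3.49) for `P(U)`, (3.68) for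
# `P′(A)`, (3.70)/(3.74) for `D_{U′U} − D_U`, `D*_{U′U} − D*_U` — DISCHARGED down to Theorems 3.1/3.2 for `U`, the (3.19)/(3.57)/(3.59) letters
# and (3.37): a standalone statement of the (3.77) step (FILE 63 of the Sect. B programme of cell `lit-balaban`, seat r06 (B9 fold owner) gen 23;
# exported from the interior of FILE 44 `B9Ineq346L2RightDiffG`, where it was assembled as the `P₁`-part of the kernel of `G(U′U)V(A)`)

statement-level skeleton of published theorems with citation tags; proofs where landed; nothing here is a claim about the Yang–Mills mass gap

CITATION HEADER (lean-in-tree rule).  B9 = T. Bałaban, *Propagators for lattice gauge theories in a background field*, Commun. Math. Phys. **99** (1985)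
389–434 [Balaban1985BackgroundPropagators] (held `paper:balaban1985-cmp99-background-propagators`, journal page = PDF page + 388; page renders
`b2b-balaban-ref1/pages/1985-cmp99-background-propagators/…-p017-x2.png`, `…-p018-x2.png` re-read by this seat 2026-08-23).  (3.76) p. 405 [PDF 17]
«D_{U′U}R(U′U)D*_{U′U} = D_UR(U)D*_U − V₂(A) − (D_{U′U} − D_U)P(U)D*_U − D_UP(U)(D*_{U′U} − D*_U) − (D_{U′U} − D_U)P(U)(D*_{U′U} − D*_U)
− D_{U′U}P′(A)D*_{U′U} = DRD* − V₂(A) − P₁(A),»; (3.77) p. 406 [PDF 18, L1–4] «where the operator P₁(A) is a non-local operator whose kernel satisfies the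
bound |P_{1,μν}(A; x, x′)| ≦ O(1)α₁(Lʲη)⁻²(L^{j′}η)^{−d}e^{−(1/2)δ₀d(y,y′)} for x ∈ Δ(y), y ∈ Λ_j, x′ ∈ Δ(y′), y′ ∈ Λ_{j′}. (3.77)»; (3.49) p. 399
(the four kernel members of `P = I − R`, rate `(1/2)δ₀`); (3.25) p. 394 «Rf = (I − G′Q′*(Q′G′²Q′*)⁻¹Q′G′)f»; (3.68) p. 403 (the four kernel members of
`P′(A) = P(U′U) − P(U)`, factor `α₁`, rate `(1/2)δ₀`); (3.70) p. 404, (3.74) p. 405 (the sizes `O(1)α₁(Lʲη)⁻¹` of `D_{U′U} − D_U`, `D*_{U′U} − D*_U`);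
Theorem 3.1 (3.42) p. 397, Theorem 3.2 (3.21)/(3.48) pp. 394/398, (3.19) p. 393, (3.37) p. 396, (3.57)/(3.59) pp. 401–402; p. 398 [PDF 10] L20–24 «Next, the
choice of powers Lʲη is conventional also. Using Lemma 2.1 in [4] we may replace the factor (Lʲη)^α by (Lʲη)^β(L^{j′}η)^γ with β + γ = α, j, j′ are
indices of localizations».  [4] = [Balaban1984PropagatorsII] T. Bałaban, *Propagators and renormalization transformations for lattice gauge theories.
II*, Commun. Math. Phys. **96** (1984) 223–250: (2.51)–(2.55) p. 232, Lemma 2.1 (2.60)–(2.61) p. 234, (2.64)–(2.66) p. 234 (the kernel shape).  Rows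
B9.Eq3.76 × B9.Eq3.49 × B9.Eq3.68 (cells; heads are the lead's word).

WHAT IS PROVED (one theorem: 0 `def`, 0 sorry, 0 named facts; standard axioms).  **`ineq377_kernel_final`** — HYPOTHESES = FILE 33
`B9Thm34PPrimeKernelFinal.thm34_pPrime_kernel_final` VERBATIM (geometry axioms, [4] Lemma 2.1 «for every 0 < α < 1», the p. 398 transfers for every
exponent, real coordinates `b`, unitary-type `U`, stencil range `d₀`, the `A`-free (3.60) data, Theorem 3.1 for `G′(U)` — (3.42)₁₋₃ as block majorants,
(3.42)₁₋₄ as kernel bounds, `G′(U) = (Δ′_a(U))⁻¹` —, the (3.19) letters with a section `rep`, Theorem 3.2 for `U` — (3.21) `hLinv`, (3.48) `h348`)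
PLUS ONE transfer `hTv` of the block-volume weight `v⁻¹ = (L^{j′}η)^{−d}` at exponent `δ₀/50` ([4] (2.60)); CONCLUSION `∃ a₁ > 0 ∃ K ≧ 0 ∀ α₁ ∈ [0, a₁]
∀ A` in (3.37) (blockwise, FILE 33's seven shapes) `∀` (3.57)/(3.59) letters `Q′(U′U) = Q′ + F′₂`, `Q′*(U′U) = Q′* + F′₂*` (block-local, size `c_Fα₁`):
THERE EXISTS `C⁻¹(U′U)` (two-sided inverse of `Q′(U′U)G′²(U′U)Q′*(U′U)`, FILE 33's, re-exported) such that print's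
`P₁(A) = (D_{U′U} − D_U)∘P(U)∘D*_U + D_U∘P(U)∘(D*_{U′U} − D*_U) + (D_{U′U} − D_U)∘P(U)∘(D*_{U′U} − D*_U) + D_{U′U}∘P′(A)∘D*_{U′U}` — typed letters
`conjHom b (gradLin T η⁻¹ ·)`, `conjHom b (divLin T η⁻¹ ·)` at `U` and `U′U = prodCfg U η A` ((3.3)/(3.8), (3.70)/(3.74)), `P(U) = G′∘Q′*∘C⁻¹∘Q′∘G′`
((3.25); the word of FILE 28's concrete `Δ_a(U)`), `P′(A) = B9Eq360Vprime.pPrime …` ((3.68), FILE 33's) — has the PRINTED KERNEL BOUND on the bond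
carrier `|P₁(A)((μ,x,i),(ν,x′,i′))| ≦ K·α₁·(Lʲη)⁻²·e^{−(δ₀/5)d(y,y′)}·v(y′)⁻¹`, ONE `K` independent of `α₁`, `A` and the lattice data beyond the
listed constants.  PROOF: FILE 33 (`C⁻¹(U′U)`, the (3.68) kernel members at `δ₀/4`); the middle factor `Q′*C⁻¹Q′` of `P(U)` as a block majorant
`κ_M(Lʲη)⁻⁴e^{−(δ₀/4)d}` from (3.19) + (3.48) (gen 11's `hasMajorantHom_word349`); FILE 43 `B9Ineq377POneRightKernel.hasKernelBound_pOne_right` (the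
kernel of the four words with the kernel carried by the right letter: Theorem 3.1's (3.42)₁,₂ majorants and (3.42)₁,₃ kernels for `G′(U)`, the
(3.70)/(3.74) difference letters under (3.37), [4] (2.52)/(2.55)/Lemma 2.1); the `α₁`-dependence of FILE 43's explicit constant bounded near `α₁ = 0`
by continuity (`exists_bound_of_continuousAt`).  Rates: `G′(U)` at `δ₀` → `Mid`, `P′` at `δ₀/4` → kernel at `δ₀/5`, exponents `1/100`, columns at
`δ₀/5 + δ₀/50`.

HONEST SCOPE / NOT CLAIMED.  (i) Theorems 3.1/3.2 FOR `U` are the INPUTS (rows B9.Thm3.1/3.2): the file certifies print's implication «(3.49), (3.68),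
(3.70), (3.74) ⇒ (3.77)» with (3.49)/(3.68)/(3.70)/(3.74) themselves discharged for print's own `P(U)`, `P′(A)`, `D_{U′U} − D_U`, `D*_{U′U} − D*_U` down
to those inputs (FILES 29/30/33/43/62, gen 11 `B9Eq376POneLetters`); it does not prove Theorems 3.1/3.2.  (ii) THE RATE: print keeps `(1/2)δ₀` from
(3.49)/(3.68) to (3.77); in the word `D_UP(U)(D*_{U′U} − D*_U)` the (3.37) size `α₁(L^{j′}η)⁻¹` of the right letter sits at the block of `x′` and its
exchange for `(Lʲη)⁻¹` at the block of `x` (print's uniform weight `(Lʲη)⁻²`) costs rate by [4] Lemma 2.1 (2.60) — print's O(1)/rate convention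
(p. 398 remark); the kernel here proves the rate `δ₀/5` with FILE 33's `δ₀/4` input (ONE admissible bookkeeping; every fraction is explicit, none is
optimised).  (iii) `P₁(A)` is typed, as in FILES 28/43/44, with the two-space gradient/divergence letters on the bond carrier `(κ × S) × ι` and the
`P(U)`-word in the two-space typing of the (3.19) letters (`Gp ∘ Qcs ∘ Linv ∘ Qc ∘ Gp`); `P′(A)` in FILE 33's section typing; the pairing/volume
weights `(cK, v)` are those of the site-carrier kernel hypotheses.  (iv) Group-valued background (`‖U‖, ‖U⁻¹‖ ≦ 1`), `η = g.eta > 0`, `η ≦ Lʲη`,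
`a₁ ≦ 1/4`.  NOT summit progress.

RELATED IN THE TREE, NOT DUPLICATED (searched 2026-08-23: `lean search --decl 'ineq377_kernel|POneKernelFinal'` = ∅): FILE 43
`hasKernelBound_pOne_right` (the device: `P(U) = G′·Mid·G′`, `Mid`, `P′` and their bounds as INPUTS), FILE 44 `thm34_G_l2_right_final` (assembles the
same kernel INSIDE its proof, not exported), FILE 25 `B9Thm34GKernelFinal.hasMajorant_pOne_site`/`exists_threshold_pOne` and gen 7/11
`B9Ineq377POne.ineq377_op`/`B9Ineq377POneConcrete.ineq377_concreteE` ((3.77) as block MAJORANTS, operator form), FILE 62 `B9Ineq349KernelU` ((3.49) for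
`P(U)` in kernel form at the printed rate).  Here: the standalone kernel form of (3.77) for print's own `P₁(A)`.
-/

noncomputable section

namespace Literature.MathematicalPhysics.QuantumFieldTheory.Balaban1983to89.B9Ineq377POneKernelFinal

open NormedSpace Complex
open Literature.MathematicalPhysics.QuantumFieldTheory.Balaban1983to89
open Literature.MathematicalPhysics.QuantumFieldTheory.Balaban1983to89.B6RandomWalk (HasMajorant BlockSupp hasMajorant_mono Triangle254 Ineq261)
open Literature.MathematicalPhysics.QuantumFieldTheory.Balaban1983to89.B6RandomWalkHom (HasMajorantHom hasMajorantHom_iff hasMajorantHom_mono)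
open Literature.MathematicalPhysics.QuantumFieldTheory.Balaban1983to89.B6RandomWalkKernel (HasKernelBound hasKernelBound_mono)
open Literature.MathematicalPhysics.QuantumFieldTheory.Balaban1983to89.B6RandomWalkSection (secExt secRes secConj hasMajorant_id_of_ker)
open Literature.MathematicalPhysics.QuantumFieldTheory.Balaban1983to89.B9Thm34Ext (toB6)
open Literature.MathematicalPhysics.QuantumFieldTheory.Balaban1983to89.B9Ineq347 (ScaleTransfer)
open Literature.MathematicalPhysics.QuantumFieldTheory.Balaban1983to89.B9Eq39Adjoint
open Literature.MathematicalPhysics.QuantumFieldTheory.Balaban1983to89.B9Eq352DivForm (tauB)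
open Literature.MathematicalPhysics.QuantumFieldTheory.Balaban1983to89.B9Eq352DivFormLetters
open Literature.MathematicalPhysics.QuantumFieldTheory.Balaban1983to89.B9Eq352GradLetters (diffLetter)
open Literature.MathematicalPhysics.QuantumFieldTheory.Balaban1983to89.B9Eq376POneLetters (conjHom gradLin divLin)
open Literature.MathematicalPhysics.QuantumFieldTheory.Balaban1983to89.B9Eq360Vprime (gPrimeExtEnd pOp pPrime)
open Literature.MathematicalPhysics.QuantumFieldTheory.Balaban1983to89.B9Eq360VprimeLetters (vPrimeConc)
open Literature.MathematicalPhysics.QuantumFieldTheory.Balaban1983to89.B9Thm34GKernelFinal (exists_bound_of_continuousAt)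
open Literature.MathematicalPhysics.QuantumFieldTheory.Balaban1983to89.B9Thm34PPrimeKernelFinal (thm34_pPrime_kernel_final)
open Literature.MathematicalPhysics.QuantumFieldTheory.Balaban1983to89.B9Ineq349Hom (hasMajorantHom_word349)
open Literature.MathematicalPhysics.QuantumFieldTheory.Balaban1983to89.B9Ineq377POneRightKernel (hasKernelBound_pOne_right)

section Final

variable {𝔸 : Type*} [NormedRing 𝔸] [NormedAlgebra ℂ 𝔸] [CompleteSpace 𝔸] {ι : Type} [Fintype ι]
variable (b : Module.Basis ι ℝ 𝔸) {S : Type} {κ : Type} [Fintype κ]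
variable (T : κ → Equiv.Perm S) (U : κ → S → 𝔸ˣ)
variable {g : B9.Geometry} [Fintype g.Site] {Rr : ℝ} {H : Prop}

set_option maxHeartbeats 3200000 in
/-- **(3.77) IN THE PRINTED KERNEL FORM FOR PRINT'S OWN `P₁(A)`, INPUTS DISCHARGED DOWN TO THEOREMS 3.1/3.2 FOR `U`** — p. 406 «the operator P₁(A) is a
non-local operator whose kernel satisfies the bound |P_{1,μν}(A;x,x′)| ≦ O(1)α₁(Lʲη)⁻²(L^{j′}η)^{−d}e^{−(1/2)δ₀d(y,y′)} for x ∈ Δ(y), y ∈ Λ_j, x′ ∈ Δ(y′),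
y′ ∈ Λ_{j′}»: hypotheses = FILE 33 `thm34_pPrime_kernel_final` verbatim + the `v⁻¹`-transfer `hTv`; `∃ a₁ > 0 ∃ K ≧ 0 ∀ α₁ ≦ a₁ ∀ A …`: FILE 33's
`C⁻¹(U′U)` (re-exported) and `|P₁(A)(q,q′)| ≦ Kα₁(Lʲη)⁻²e^{−(δ₀/5)d(y,y′)}v(y′)⁻¹` for the four-word `P₁(A)` of (3.76) with `P(U) = G′Q′*C⁻¹Q′G′`
and `P′(A)` of (3.68) written out.  Proof: FILE 33 + (3.19)/(3.48) middle factor + FILE 43, constant by continuity in `α₁`.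
[cite: Balaban1985BackgroundPropagators, (3.76)–(3.77) pp.405–406 + (3.49) p.399 + (3.25) p.394 + (3.68) p.403 + (3.70) p.404 + (3.74) p.405 + Thm 3.1 (3.42) p.397 + Thm 3.2 (3.48) p.398 + (3.19)/(3.21) pp.393–394 + (3.37) p.396 + (3.57)/(3.59) pp.401–402 + p.398 remark; Balaban1984PropagatorsII, (2.51)–(2.55) p.232 + Lemma 2.1 (2.60)–(2.61) p.234 + (2.64)–(2.66) p.234] -/
theorem ineq377_kernel_final [Fintype S] [DecidableEq κ] [DecidableEq S] [DecidableEq ι] [DecidableEq g.Site] [Nonempty g.Site] (blk : S → g.Site) (d : ℕ)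
    (δ₀ κQ BG B₁ cF Cq a₀ d₀ M₂ : ℝ)
    (kQ : g.Site → S → 𝔸 →L[ℝ] 𝔸) (sQ : S → 𝔸 →L[ℝ] 𝔸) (cfun w : g.Site → ℝ)
    (hκQ : 0 < κQ) (hBG : 0 < BG) (hB₁ : 0 < B₁) (hcF : 0 < cF) (hCq : 0 ≤ Cq) (ha₀ : 0 ≤ a₀) (hM₂ : 0 ≤ M₂) (hδ₀ : 0 < δ₀)
    -- the multiscale geometry 𝔅 and its axioms
    (hdnn : ∀ a a' : g.Site, 0 ≤ g.dist a a') (htri : Triangle254 (toB6 g Rr H)) (hrefl : ∀ y : g.Site, g.dist y y = 0)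
    (hsym : ∀ y y' : g.Site, g.dist y y' = g.dist y' y) (hlen : ∀ y : g.Site, 0 < g.len y) (hlenη : ∀ y : g.Site, g.eta ≤ g.len y)
    (hη : 0 < g.eta)
    -- [4] Lemma 2.1 (2.61) at the rate `δ₀`, «for every 0 < α < 1», and the p. 398 scale transfer for every exponent
    (h261 : ∀ α : ℝ, 0 < α → α < 1 → Ineq261 d (toB6 g Rr H) δ₀ α)
    (hST : ∀ α : ℝ, 0 < α → ∃ Λ : ℝ, 1 ≤ Λ ∧ ScaleTransfer g δ₀ α Λ (fun a => g.len a) ∧ ScaleTransfer g δ₀ α Λ (fun a => g.len a ^ 2) ∧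
      ScaleTransfer g δ₀ α Λ (fun a => (g.len a)⁻¹) ∧ ScaleTransfer g δ₀ α Λ (fun a => (g.len a ^ 2)⁻¹) ∧
      ScaleTransfer g δ₀ α Λ (fun a => (g.len a ^ 4)⁻¹) ∧ ScaleTransfer g δ₀ α Λ (fun y => g.len y ^ (-(4 : ℝ))))
    (hrepr : ∀ (v : 𝔸) (i : ι), |b.repr v i| ≤ M₂ * ‖v‖)
    (hU1 : ∀ m z, ‖((U m z : 𝔸ˣ) : 𝔸)‖ ≤ 1 ∧ ‖(((U m z)⁻¹ : 𝔸ˣ) : 𝔸)‖ ≤ 1)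
    (hd₀B : ∀ μ x, g.dist (blk x) (blk ((T μ).symm x)) ≤ d₀) (hd₀F : ∀ μ x, g.dist (blk x) (blk (T μ x)) ≤ d₀)
    (hd₀0 : ∀ y : g.Site, g.dist y y ≤ d₀)
    -- the `A`-independent data of the concrete `V′(A)` of (3.60)
    (hw : ∀ y, 0 ≤ w y) (hcard : ∀ y, ((B9Eq360Vprime.block blk y).card : ℝ) * w y ≤ 1)
    (hkQ : ∀ y x, blk x = y → ‖kQ y x‖ ≤ w y) (hsQ : ∀ x, ‖sQ x‖ ≤ 1) (hcfun : ∀ y, |cfun y| ≤ a₀ * (g.len y ^ 2)⁻¹)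
    -- THEOREM 3.1 for `G′(U)`: (3.42)₁,₂,₃ at the rate `δ₀`
    {Gp : Module.End ℝ (S × ι → ℝ)}
    (h342_1 : HasMajorant (g := toB6 g Rr H) (fun p : S × ι => blk p.1) Gp
      (fun a a' => BG * g.len a ^ 2 * Real.exp (-(δ₀ * g.dist a a'))))
    (h342_2 : ∀ k : κ ⊕ κ, HasMajorant (g := toB6 g Rr H) (fun p : S × ι => blk p.1)
      (conj b (diffLetter T U ((g.eta : ℂ)⁻¹) k) * Gp) (fun a a' => BG * g.len a * Real.exp (-(δ₀ * g.dist a a'))))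
    (h342_3 : ∀ k : κ ⊕ κ, HasMajorant (g := toB6 g Rr H) (fun p : S × ι => blk p.1)
      (Gp * conj b (diffLetter T U ((g.eta : ℂ)⁻¹) k)) (fun a a' => BG * g.len a * Real.exp (-(δ₀ * g.dist a a'))))
    -- the (3.19) letters `Q′(U)`, `Q′*(U)` in their own typing with block-local two-space majorants, a section of the block map (FILE 17)
    (rep : g.Site → S × ι) (hrep : ∀ y : g.Site, blk (rep y).1 = y)
    {Qc : (S × ι → ℝ) →ₗ[ℝ] (g.Site → ℝ)} {Qcs : (g.Site → ℝ) →ₗ[ℝ] (S × ι → ℝ)} {Linv : Module.End ℝ (g.Site → ℝ)}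
    (hQc : HasMajorantHom (g := toB6 g Rr H) (fun p : S × ι => blk p.1) (fun y : g.Site => y) Qc
      (fun a a' : g.Site => κQ * (if a = a' then (1 : ℝ) else 0)))
    (hQcs : HasMajorantHom (g := toB6 g Rr H) (fun y : g.Site => y) (fun p : S × ι => blk p.1) Qcs
      (fun a a' : g.Site => κQ * (if a = a' then (1 : ℝ) else 0)))
    -- THEOREM 3.2 for `U`: (3.21) `C⁻¹ = (Q′G′²Q′*)⁻¹` exists (`hLinv`) with the KERNEL bound (3.48) at the rate `δ₀`
    (hLinv : (Qc ∘ₗ (Gp * Gp) ∘ₗ Qcs) * Linv = 1)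
    (h348 : ∀ y y' : g.Site, |B9Thm34Inv.ker (B9Thm34Inv.vol g d) Linv y y'| ≤
      B₁ * g.len y ^ (-(4 : ℝ)) * g.len y' ^ (-(d : ℝ)) * Real.exp (-(δ₀ * g.dist y y')))
    -- THEOREM 3.1 for `G′(U)`: the letter `Δ′_a(U)` with `G′(U)` its two-sided inverse ((3.26); FILE 26)
    {Δp : Module.End ℝ (S × ι → ℝ)} (hΔpGp : Δp * Gp = 1) (hGpΔp : Gp * Δp = 1)
    -- the kernel pairing of p. 393 (`c = η^d`, block volume weight `v(y′) = (L^{j′}η)^d`) and THEOREM 3.1's (3.42)₁₋₄ FOR `G′(U)` IN THE PRINTED KERNEL FORM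
    {v : g.Site → ℝ} (hv : ∀ y, 0 < v y) {cK : ℝ} (hcK : 0 < cK)
    (hGpk : HasKernelBound (g := toB6 g Rr H) (fun p : S × ι => blk p.1) v cK Gp
      (fun a a' => BG * g.len a ^ 2 * Real.exp (-(δ₀ * g.dist a a'))))
    (hDGpk : ∀ k : κ ⊕ κ, HasKernelBound (g := toB6 g Rr H) (fun p : S × ι => blk p.1) v cK
      (conj b (diffLetter T U ((g.eta : ℂ)⁻¹) k) * Gp) (fun a a' => BG * g.len a * Real.exp (-(δ₀ * g.dist a a'))))
    (hGpDk : ∀ l : κ ⊕ κ, HasKernelBound (g := toB6 g Rr H) (fun p : S × ι => blk p.1) v cK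
      (Gp * conj b (diffLetter T U ((g.eta : ℂ)⁻¹) l)) (fun a a' => BG * g.len a * Real.exp (-(δ₀ * g.dist a a'))))
    (hDGpDk : ∀ k l : κ ⊕ κ, HasKernelBound (g := toB6 g Rr H) (fun p : S × ι => blk p.1) v cK
      (conj b (diffLetter T U ((g.eta : ℂ)⁻¹) k) * Gp * conj b (diffLetter T U ((g.eta : ℂ)⁻¹) l)) (fun a a' => BG * Real.exp (-(δ₀ * g.dist a a'))))
    -- [4] Lemma 2.1 (2.60) for the block-volume weight `v⁻¹ = (L^{j′}η)^{−d}` at the exponent `δ₀/50` (the transfer of the kernel factor)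
    (Λv : ℝ) (hΛv : 0 ≤ Λv) (hTv : ∀ a a' : g.Site, Real.exp (-(1 / 50 * δ₀ * g.dist a a')) * (v a)⁻¹ ≤ Λv * (v a')⁻¹) :
    ∃ a₁ : ℝ, 0 < a₁ ∧ ∃ K : ℝ, 0 ≤ K ∧
    ∀ (α₁ : ℝ), 0 ≤ α₁ → α₁ ≤ a₁ →
    -- the exponent field `A` in the domain (3.37), read blockwise, and the `A`-dependent (3.59) data `kF`, `sF`
    ∀ (A : κ → S → 𝔸) (kF : g.Site → S → 𝔸 →L[ℝ] 𝔸) (sF : S → 𝔸 →L[ℝ] 𝔸),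
      (∀ y x, blk x = y → ‖kF y x‖ ≤ Cq * α₁ * w y) → (∀ x, ‖sF x‖ ≤ Cq * α₁) →
      (∀ ν k x, ‖((g.eta : ℂ)⁻¹) • covDstar T U ν (A k) x‖ ≤ α₁ * (g.len (blk x) ^ 2)⁻¹) →
      (∀ μ ν x, ‖((g.eta : ℂ)⁻¹) • covD T U μ (A ν) x‖ ≤ α₁ * (g.len (blk x) ^ 2)⁻¹) →
      (∀ μ x, ‖((g.eta : ℂ)⁻¹) • covDstar T U μ (tauB T U μ (A μ)) x‖ ≤ α₁ * (g.len (blk x) ^ 2)⁻¹) →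
      (∀ k x, ‖A k x‖ ≤ α₁ * (g.len (blk x))⁻¹) → (∀ ν k x, ‖tauB T U ν (A k) x‖ ≤ α₁ * (g.len (blk x))⁻¹) →
    -- the (3.57)/(3.59) letters `F′₂(A)`, `F′₂*(A)` (block-local, size `c_F α₁`)
    ∀ {Qc' Fc : (S × ι → ℝ) →ₗ[ℝ] (g.Site → ℝ)} {Qcs' Fcs : (g.Site → ℝ) →ₗ[ℝ] (S × ι → ℝ)},
      Qc' = Qc + Fc → Qcs' = Qcs + Fcs →
      HasMajorantHom (g := toB6 g Rr H) (fun p : S × ι => blk p.1) (fun y : g.Site => y) Fc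
        (fun a a' : g.Site => cF * α₁ * (if a = a' then (1 : ℝ) else 0)) →
      HasMajorantHom (g := toB6 g Rr H) (fun y : g.Site => y) (fun p : S × ι => blk p.1) Fcs
        (fun a a' : g.Site => cF * α₁ * (if a = a' then (1 : ℝ) else 0)) →
    ∃ Tinv : Module.End ℝ (g.Site → ℝ),
      Tinv * (Qc' ∘ₗ ((gPrimeExtEnd Gp (conj b (vPrimeConc T U g.eta A blk kQ kF sQ sF cfun) * Gp)) * (gPrimeExtEnd Gp (conj b (vPrimeConc T U g.eta A blk kQ kF sQ sF cfun) * Gp))) ∘ₗ Qcs') = 1 ∧ (Qc' ∘ₗ ((gPrimeExtEnd Gp (conj b (vPrimeConc T U g.eta A blk kQ kF sQ sF cfun) * Gp)) * (gPrimeExtEnd Gp (conj b (vPrimeConc T U g.eta A blk kQ kF sQ sF cfun) * Gp))) ∘ₗ Qcs') * Tinv = 1 ∧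
      -- (3.77): THE KERNEL OF PRINT'S `P₁(A) = (D_{U′U} − D_U)P(U)D*_U + D_UP(U)(D*_{U′U} − D*_U) + (D_{U′U} − D_U)P(U)(D*_{U′U} − D*_U) + D_{U′U}P′(A)D*_{U′U}`
      HasKernelBound (g := toB6 g Rr H) (fun q : (κ × S) × ι => blk q.1.2) v cK
        ((conjHom b (gradLin T ((g.eta : ℂ)⁻¹) (prodCfg U g.eta A)) - conjHom b (gradLin T ((g.eta : ℂ)⁻¹) U))
            ∘ₗ (Gp ∘ₗ Qcs ∘ₗ Linv ∘ₗ Qc ∘ₗ Gp) ∘ₗ conjHom b (divLin T ((g.eta : ℂ)⁻¹) U)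
          + conjHom b (gradLin T ((g.eta : ℂ)⁻¹) U) ∘ₗ (Gp ∘ₗ Qcs ∘ₗ Linv ∘ₗ Qc ∘ₗ Gp)
            ∘ₗ (conjHom b (divLin T ((g.eta : ℂ)⁻¹) (prodCfg U g.eta A)) - conjHom b (divLin T ((g.eta : ℂ)⁻¹) U))
          + (conjHom b (gradLin T ((g.eta : ℂ)⁻¹) (prodCfg U g.eta A)) - conjHom b (gradLin T ((g.eta : ℂ)⁻¹) U))
            ∘ₗ (Gp ∘ₗ Qcs ∘ₗ Linv ∘ₗ Qc ∘ₗ Gp)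
            ∘ₗ (conjHom b (divLin T ((g.eta : ℂ)⁻¹) (prodCfg U g.eta A)) - conjHom b (divLin T ((g.eta : ℂ)⁻¹) U))
          + conjHom b (gradLin T ((g.eta : ℂ)⁻¹) (prodCfg U g.eta A)) ∘ₗ (B9Eq360Vprime.pPrime Gp (gPrimeExtEnd Gp (conj b (vPrimeConc T U g.eta A blk kQ kF sQ sF cfun) * Gp)) (Qcs ∘ₗ secRes rep) (Qcs' ∘ₗ secRes rep) (secConj rep Linv) (secConj rep Tinv) (secExt rep ∘ₗ Qc) (secExt rep ∘ₗ Qc'))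
            ∘ₗ conjHom b (divLin T ((g.eta : ℂ)⁻¹) (prodCfg U g.eta A)))
        (fun a a' => K * α₁ * (g.len a ^ 2)⁻¹ * Real.exp (-(1 / 5 * δ₀ * g.dist a a'))) := by
  classical
  -- FILE 33: `C⁻¹(U′U)` and the (3.68) kernel members of `P′(A)` (rate `δ₀/4`)
  obtain ⟨a₃, ha₃, KP, hKP, H33⟩ := thm34_pPrime_kernel_final (Rr := Rr) (H := H) b T U blk d δ₀ κQ BG B₁ cF Cq a₀ d₀ M₂ kQ sQ cfun w hκQ
    hBG hB₁ hcF hCq ha₀ hM₂ hδ₀ hdnn htri hrefl hsym hlen hlenη hη h261 hST hrepr hU1 hd₀B hd₀F hd₀0 hw hcard hkQ hsQ hcfun h342_1 h342_2 h342_3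
    rep hrep hQc hQcs hLinv h348 hΔpGp hGpΔp hv hcK hGpk hDGpk hGpDk hDGpDk
  -- the geometry: exponents `1/100` at the printed rate `δ₀`
  obtain ⟨Λ, hΛ1, hT1, hT2, hT1i, hT2i, hT4i, -⟩ := hST (1 / 100) (by norm_num)
  have hΛ0 : 0 ≤ Λ := zero_le_one.trans hΛ1
  have h261β : Ineq261 d (toB6 g Rr H) δ₀ (1 / 100) := h261 _ (by norm_num) (by norm_num)
  have hc1 : 0 ≤ B6.c1 d δ₀ (1 / 100) := B6RandomWalk.c1_nonneg d δ₀ (1 / 100)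
  have hSTone : ScaleTransfer g δ₀ (1 / 100) Λ (fun _ : g.Site => (1 : ℝ)) := fun y y' => by
    simp only [mul_one]
    have h0 : 0 ≤ 1 / 100 * δ₀ * g.dist y y' := mul_nonneg (by linarith only [hδ₀]) (hdnn y y')
    exact (Real.exp_le_one_iff.mpr (by linarith)).trans hΛ1
  -- THE MIDDLE FACTOR `Q′*C⁻¹Q′` OF `P(U) = G′Q′*C⁻¹Q′G′` ((3.25)): block majorant `κ_M(Lʲη)⁻⁴e^{−(δ₀/4)d}` from (3.19) and the (3.48) kernel bound
  have hr4 : ∀ a : g.Site, g.len a ^ (-(4 : ℝ)) = (g.len a ^ 4)⁻¹ := fun a => by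
    rw [Real.rpow_neg (hlen a).le, show (4 : ℝ) = ((4 : ℕ) : ℝ) by norm_num, Real.rpow_natCast]
  have hLi : HasMajorant (g := toB6 g Rr H) (fun y : g.Site => y) Linv (fun a a' => B₁ * (g.len a ^ 4)⁻¹ * Real.exp (-(δ₀ * g.dist a a'))) :=
    hasMajorant_mono (g := toB6 g Rr H) _
      (hasMajorant_id_of_ker (R := Rr) (H := H) d hlen B₁ (fun y => g.len y ^ (-(4 : ℝ))) (fun y y' => Real.exp (-(δ₀ * g.dist y y'))) h348)
      fun a a' => le_of_eq (by simp only [hr4])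
  have hQc1 : HasMajorantHom (g := toB6 g Rr H) (fun p : S × ι => blk p.1) (fun y : g.Site => y) Qc (fun a a' : g.Site => if a = a' then κQ else 0) :=
    hasMajorantHom_mono (g := toB6 g Rr H) _ _ hQc fun a a' => le_of_eq (by split_ifs <;> simp)
  have hQcs1 : HasMajorantHom (g := toB6 g Rr H) (fun y : g.Site => y) (fun p : S × ι => blk p.1) Qcs (fun a a' : g.Site => if a = a' then κQ else 0) :=
    hasMajorantHom_mono (g := toB6 g Rr H) _ _ hQcs fun a a' => le_of_eq (by split_ifs <;> simp)
  have hId : HasMajorantHom (g := toB6 g Rr H) (fun p : S × ι => blk p.1) (fun p : S × ι => blk p.1) (LinearMap.id : (S × ι → ℝ) →ₗ[ℝ] (S × ι → ℝ))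
      (fun a a' => (1 : ℝ) * (fun _ : g.Site => (1 : ℝ)) a * Real.exp (-(δ₀ * g.dist a a'))) := by
    intro y' μ Bμ hμ x
    rw [LinearMap.id_apply]
    dsimp only
    by_cases hx : blk x.1 = y'
    · rw [hx, hrefl, mul_zero, neg_zero, Real.exp_zero]
      simpa using hμ.bound x hx
    · rw [hμ.off x hx, abs_zero]
      exact mul_nonneg (by positivity) hμ.nonneg
  have hrM : 1 / 4 * δ₀ + (2 * (1 / 100) + 1 / 100) * δ₀ ≤ δ₀ := by linarith only [hδ₀]
  have hδ4 : (0 : ℝ) ≤ 1 / 4 * δ₀ := by linarith only [hδ₀]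
  have hMid0 := hasMajorantHom_word349 (R := Rr) (H := H) (fun p : S × ι => blk p.1) (fun p : S × ι => blk p.1) (fun p : S × ι => blk p.1)
    (fun y : g.Site => y) d δ₀ δ₀ (1 / 100) (1 / 100) (1 / 4 * δ₀) Λ κQ 1 B₁ 1 (fun _ => (1 : ℝ)) (fun _ => (1 : ℝ)) (fun _ => zero_le_one)
    (fun _ => zero_le_one) hκQ.le zero_le_one hB₁.le zero_le_one hΛ1 hδ4 (by norm_num) (by norm_num) hδ₀.le hrM hdnn htri h261β hSTone hT4i
    hId hId hQc1 hQcs1 hLi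
  rw [LinearMap.id_comp, LinearMap.comp_id] at hMid0
  set κM : ℝ := κQ ^ 2 * B₁ * Λ ^ 4 * B6.c1 d δ₀ (1 / 100) ^ 2 with hκM
  have hκM0 : 0 ≤ κM := by rw [hκM]; positivity
  have hMid : HasMajorant (g := toB6 g Rr H) (fun p : S × ι => blk p.1) (Qcs ∘ₗ Linv ∘ₗ Qc)
      (fun a a' => κM * (g.len a ^ 4)⁻¹ * Real.exp (-(1 / 4 * δ₀ * g.dist a a'))) :=
    (hasMajorantHom_iff (g := toB6 g Rr H) _ _ _).mp (hasMajorantHom_mono (g := toB6 g Rr H) _ _ hMid0 fun a a' => le_of_eq (by rw [hκM]; ring))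
  -- THE CONSTANT OF (3.77) as a function of `α₁` (FILE 43's explicit `K₁`), bounded near `α₁ = 0` by continuity («O(1)»)
  set C2 : ℝ → ℝ := fun t =>
    ((4 * (M₂ * ∑ i, ‖b i‖) * Real.exp (29 / 100 * δ₀ * d₀)) * BG * κM * BG * (Λ * B6.c1 d δ₀ (1 / 100)) ^ 3
        + BG * κM * BG * ((Fintype.card ι * M₂ * ∑ i, ‖b i‖) * (4 * Real.exp ((1 / 5 * δ₀ + 1 / 50 * δ₀) * d₀))) * Λv * (Λ * B6.c1 d δ₀ (1 / 100)) ^ 3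
        + ((4 * (M₂ * ∑ i, ‖b i‖) * Real.exp (29 / 100 * δ₀ * d₀)) * t * BG * (Λ * B6.c1 d δ₀ (1 / 100))) * κM * BG
            * ((Fintype.card ι * M₂ * ∑ i, ‖b i‖) * (4 * Real.exp ((1 / 5 * δ₀ + 1 / 50 * δ₀) * d₀))) * Λv * (Λ * B6.c1 d δ₀ (1 / 100)) ^ 3
        + KP * (1 + (4 * (M₂ * ∑ i, ‖b i‖) * Real.exp (27 / 100 * δ₀ * d₀)) * t * (Λ * B6.c1 d δ₀ (1 / 100))
            + ((Fintype.card ι * M₂ * ∑ i, ‖b i‖) * (4 * Real.exp ((1 / 5 * δ₀ + 1 / 50 * δ₀) * d₀))) * t * (Λv * Λ * B6.c1 d δ₀ (1 / 100))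
            + (4 * (M₂ * ∑ i, ‖b i‖) * Real.exp (27 / 100 * δ₀ * d₀)) * ((Fintype.card ι * M₂ * ∑ i, ‖b i‖) * (4 * Real.exp ((1 / 5 * δ₀ + 1 / 50 * δ₀) * d₀))) * t ^ 2
                * (Λv * (Λ * B6.c1 d δ₀ (1 / 100)) ^ 2))) with hC2
  obtain ⟨KW, ε₁, hKW, hε₁, hFW⟩ := exists_bound_of_continuousAt (f := C2) (by simp only [hC2]; fun_prop)
  refine ⟨min (min a₃ (1 / 4)) (ε₁ / 2), lt_min (lt_min ha₃ (by norm_num)) (half_pos hε₁), KW, hKW, ?_⟩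
  intro α₁ hα₁0 hα₁1 A kF sF hkF hsF h337B h337F h337Bτ hA hAτB Qc' Fc Qcs' Fcs h357 h357s hFc hFcs
  have hα₁b : α₁ ≤ a₃ := hα₁1.trans ((min_le_left _ _).trans (min_le_left _ _))
  have hα₁q : α₁ ≤ 1 / 4 := hα₁1.trans ((min_le_left _ _).trans (min_le_right _ _))
  have habs : |α₁| = α₁ := abs_of_nonneg hα₁0
  have hα₁ε₁ : |α₁| < ε₁ := by rw [habs]; linarith only [hα₁1, min_le_right (min a₃ (1 / 4)) (ε₁ / 2), hε₁]
  -- FILE 33 at this `α₁`, `A`: `C⁻¹(U′U)` and the (3.68) kernel members of `P′(A)`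
  obtain ⟨Tinv, f1, f2, -, kP0, kP1, kP2, kP3⟩ := H33 α₁ hα₁0 hα₁b A kF sF hkF hsF h337B h337F h337Bτ hA hAτB h357 h357s hFc hFcs
  refine ⟨Tinv, f1, f2, ?_⟩
  -- «η·α₁(Lʲη)⁻¹ ≦ 1/4»
  have hsmall : ∀ z : g.Site, g.eta * (α₁ * (g.len z)⁻¹) ≤ 1 / 4 := fun z => by
    have hq : g.eta * (g.len z)⁻¹ ≤ 1 := by
      rw [← div_eq_mul_inv]; exact (div_le_one (hlen z)).mpr (hlenη z)
    calc g.eta * (α₁ * (g.len z)⁻¹) = α₁ * (g.eta * (g.len z)⁻¹) := by ring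
      _ ≤ α₁ * 1 := mul_le_mul_of_nonneg_left hq hα₁0
      _ ≤ 1 / 4 := by linarith only [hα₁q]
  -- rates: kernel `δ₀/5` ← `P′`/`Mid` at `δ₀/4` ← `27δ₀/100` ← `29δ₀/100 ≦ δ₀` for `G′`, exponents `1/100`, columns at `δ₀/5 + δ₀/50`
  have hρ0 : (0 : ℝ) ≤ 1 / 5 * δ₀ := by linarith only [hδ₀]
  have hγ0 : (0 : ℝ) ≤ 1 / 50 * δ₀ := by linarith only [hδ₀]
  have hs1 : 1 / 5 * δ₀ + (1 / 100 + 1 / 100) * δ₀ ≤ 1 / 4 * δ₀ := by linarith only [hδ₀]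
  have hs2 : 1 / 4 * δ₀ + (1 / 100 + 1 / 100) * δ₀ ≤ 27 / 100 * δ₀ := by linarith only [hδ₀]
  have hs3 : 27 / 100 * δ₀ + (1 / 100 + 1 / 100) * δ₀ ≤ 29 / 100 * δ₀ := by linarith only [hδ₀]
  have hP1k := hasKernelBound_pOne_right (Rr := Rr) (H := H) b T U blk d hη A d₀ M₂ δ₀ (1 / 100) (1 / 100) (1 / 50 * δ₀) (1 / 5 * δ₀)
    (1 / 4 * δ₀) (27 / 100 * δ₀) (29 / 100 * δ₀) δ₀ (1 / 4 * δ₀) (1 / 4 * δ₀) Λ Λv BG κM KP α₁ hBG.le hκM0 hKP hα₁0 hM₂ hΛ1 hΛv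
    hρ0 (by norm_num) (by norm_num) hγ0 hδ₀.le hs1 hs2 hs3 (by linarith only [hδ₀]) le_rfl le_rfl hdnn htri hlen h261β
    hT1 hT2 hT1i hT2i hT4i hv hcK hTv hrepr hU1 hA (fun ν x => hAτB ν ν x) hsmall hd₀F hd₀B
    (R := (Gp ∘ₗ Qcs ∘ₗ Linv ∘ₗ Qc ∘ₗ Gp)) (Mid := Qcs ∘ₗ Linv ∘ₗ Qc) rfl h342_1 (fun μ => h342_2 (Sum.inl μ)) hGpk
    (fun ν => hGpDk (Sum.inr ν)) hMid kP0 (fun μ => kP1 (Sum.inl μ)) (fun ν => kP2 (Sum.inr ν)) (fun μ ν => kP3 (Sum.inl μ) (Sum.inr ν))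
  have hC2le : C2 α₁ ≤ KW := hFW α₁ hα₁ε₁
  refine hasKernelBound_mono (g := toB6 g Rr H) _ hv hP1k fun a a' => ?_
  have hpos : 0 ≤ α₁ * (g.len a ^ 2)⁻¹ * Real.exp (-(1 / 5 * δ₀ * g.dist a a')) :=
    mul_nonneg (mul_nonneg hα₁0 (inv_nonneg.mpr (sq_nonneg _))) (Real.exp_nonneg _)
  have hval : C2 α₁ * (α₁ * (g.len a ^ 2)⁻¹ * Real.exp (-(1 / 5 * δ₀ * g.dist a a'))) ≤ KW * (α₁ * (g.len a ^ 2)⁻¹ * Real.exp (-(1 / 5 * δ₀ * g.dist a a'))) :=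
    mul_le_mul_of_nonneg_right hC2le hpos
  calc _ = C2 α₁ * (α₁ * (g.len a ^ 2)⁻¹ * Real.exp (-(1 / 5 * δ₀ * g.dist a a'))) := by simp only [hC2]; ring
    _ ≤ KW * (α₁ * (g.len a ^ 2)⁻¹ * Real.exp (-(1 / 5 * δ₀ * g.dist a a'))) := hval
    _ = KW * α₁ * (g.len a ^ 2)⁻¹ * Real.exp (-(1 / 5 * δ₀ * g.dist a a')) := by ring

end Final

end Literature.MathematicalPhysics.QuantumFieldTheory.Balaban1983to89.B9Ineq377POneKernelFinal

end
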